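import Literature.AlgebraicGeometry.Resolution.AlterationsNodeLocalStructure
import Literature.AlgebraicGeometry.Resolution.AlterationsFormalNodesRegular
import Literature.AlgebraicGeometry.Resolution.AlterationsNodalFibre
import Literature.AlgebraicGeometry.Resolution.NodalDeformation
import Literature.AlgebraicGeometry.Resolution.AlterationsFormalNodesSingProofs
import Literature.AlgebraicGeometry.Resolution.PowerSeriesRegularLocal
import Literature.AlgebraicGeometry.Resolution.RegularLocalRingsQuotient
import Mathlib.RingTheory.Prime
import Literature.RingTheory.FittingIdeal.BaseChange
import Literature.RingTheory.FittingIdeal.FreeModule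
import Mathlib.RingTheory.MvPowerSeries.Substitution
import Mathlib.RingTheory.Kaehler.Basic
import HarnessLib

/-!
# De Jong 1996, 3.3: the algebra behind "`h = ε t₁^{n₁} ⋯ t_r^{n_r}`"

Topic: `Literature/AlgebraicGeometry/Resolution`. Pure commutative algebra used to discharge the
named fact `DeJong1996NodeLocalStructure` (`AlterationsNodeLocalStructure.lean`; de Jong 1996,
2.23 with 3.3) in `AlterationsNodeLocalStructureProofs.lean`:

> "3.3. … The singular locus of `f` traced on `Spec B` maps isomorphically to the closed
> subscheme `V(h) ⊂ Spec A'`. By assumption we have `V(h) ⊂ V(t₁ ⋯ t_r)`. Therefore we see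
> that `h = ε t₁^{n₁} … t_r^{n_r}`, `ε ∈ (A')^*` with `nᵢ ≥ 0` and `Σ nᵢ ≥ 2` (if `Σ nᵢ = 1`,
> then the point `x` is regular on `X`). We change `Q` into `ε⁻¹ Q`. Thus we have
> `B ≅ A'⟦u, v⟧/(Q - t₁^{n₁} … t_r^{n_r})`." (p. 63)

Everything here is PROVED, no named facts:

* `exists_isUnit_mul_prod_pow_of_mul_eq_prod_pow` — "Therefore we see that
  `h = ε t₁^{n₁} ⋯ t_r^{n_r}`": in a domain, a divisor of a product of powers of PRIME elements is
  a unit times a product of powers of them (Mathlib's `mul_eq_mul_prime_prod`; no unique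
  factorisation is needed), and `exists_pow_mem_span_singleton_of_forall_isPrime`
  (`V(h) ⊆ V(g)` gives `gᴺ ∈ (h)`);
* `DeJong1996.NodeDeformationRing.unitScale` — "We change `Q` into `ε⁻¹ Q`": for a unit `ε`,
  `A⟦u, v⟧/(uv - εp) ≅ A⟦u, v⟧/(uv - p)` (`u ↦ εu`, Mathlib's `MvPowerSeries.rescale`), fixing
  the constants;
* `DeJong1996.NodeDeformationRing.ccBar`, `DeJong1996.NodeDeformationRing.linCoeff` — for an
  ideal `𝔓 ∋ h` of `P`, the evaluation `P⟦u, v⟧/(uv - h) → P/𝔓` at `u = v = 0` and the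
  coefficients of `u` and of `v` modulo `𝔓` (well defined because `h ∈ 𝔓`), with the Leibniz
  rule `linCoeff_mul`, their values on `u`, `v` and on the constants, and
  `linCoeff_mem_of_mem_sq` (an element of `𝔪²` has linear coefficients in `𝔪_P`); these are
  the partial derivatives `∂/∂u`, `∂/∂v` along `V(u, v, 𝔓)`, by which the singular locus of
  `f` is read on the formal model;
* `fittingIdeal_kaehlerDifferential_le_ker_of_derivation` — for an `A`-algebra `B` with
  `Ω_{B/A}` finite and a field `L` under `B`: if two `A`-derivations `B → L` have an invertible
  `2 × 2` matrix of values on two elements of `B`, then `Fitt₁(Ω_{B/A}) ⊆ ker (B → L)` (Fitting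
  ideals commute with the base change to `L`,
  `Literature.RingTheory.FittingIdeal.Module.fittingIdeal_baseChange`, and
  `dim_L (L ⊗_B Ω_{B/A}) ≥ 2`);
* `DeJong1996.NodeDeformationRing.fittingIdeal_le_ker_evalZeroFrac` — the two combined: for a
  local Noetherian `A`-algebra `B` with `Ω_{B/A}` finite and a formal node structure
  `Ψ : B̂ ≅ P⟦u, v⟧/(uv - h)` under which `A` acts through constants, and a prime `𝔓 ∋ h` of the
  local ring `P` (`h ∈ 𝔪_P`), `Fitt₁(Ω_{B/A})` lies in the kernel of
  `B → B̂ → P⟦u, v⟧/(uv - h) → P/𝔓 → Frac(P/𝔓)` (`evalZeroFrac`; the values of `∂/∂u`, `∂/∂v`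
  on approximations in `B` of `u`, `v` modulo `𝔪̂²` form a matrix `≡ 1 (mod 𝔪)`);
* `DeJong1996.FormalNodeRing.isRegularLocalRing_single` — "(if `Σ nᵢ = 1`, then the point `x`
  is regular on `X`)": `k⟦u, v, T⟧/(uv - T_{i₀})` is a regular local ring (`uv - T_{i₀} ∉ 𝔪²`);
* bookkeeping: `isDomain_adicCompletion_of_eq_bot`,
  `DeJong1996.NodeDeformationRing.trans_congr_refl_comp_eq_ofBase`, `prod_pow_fin_append_zero`,
  `sum_fin_append_zero`.

Relation to `AlterationsNodalMonomialization.lean` (written in parallel for the discharge of the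
split-case fact `DeJong1996SplitNodalStructure`): that file renders the same sentence of 3.3 with
DERIVATIONS into `Λ/(h)`-modules (`coeffDerivation`, `Module.map_fittingIdeal_…_eq_bot_of_derivation`)
and absorbs the unit on `u` (`absorbUnit`); the present file works modulo an arbitrary prime
`𝔓 ∋ h` with plain functions (`linCoeff`, values in the domain `P/𝔓` and its fraction field),
which is the form consumed by the proof of `DeJong1996NodeLocalStructure_holds` (the statement
over `𝒪̂_{Y,s}` with `completedStalkMap`, including the clause "`x` regular iff `Σ nᵢ = 1`").
The two overlap in `unitScale`/`absorbUnit` and in the unit-times-prime-powers lemma; they are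
kept apart because their users' statements differ (`NodeDeformationRing` over `𝒪̂_{Y,s}` versus
`FormalNodeRing` over Cohen coordinates).

## Sources

* A. J. de Jong, *Smoothness, semi-stability and alterations*, Publ. Math. IHÉS 83 (1996), 2.23
  and 3.3 (pp. 61–63). [DeJong1996]
* D. Eisenbud, *Commutative Algebra*, GTM 150 (1995), §16.1, §20.2 (Cor. 20.5).
-/

noncomputable section

namespace Literature.AlgebraicGeometry.Resolution

universe u v w

open IsLocalRing

/-! ## Divisors of products of primes -/

section Primes

variable {R : Type u} [CommRing R]

/-- **"Therefore we see that `h = ε t₁^{n₁} ⋯ t_r^{n_r}`, `ε ∈ (A')^*`"** (de Jong 1996, 3.3): in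
an integral domain, if `x · y = (∏_{i ∈ s} pᵢ)ᴺ` for PRIME elements `pᵢ`, then `x` is a unit
times a product of powers of the `pᵢ` (peel off one prime factor at a time,
`mul_eq_mul_prime_prod`; unique factorisation is not needed). [cite: DeJong1996, 3.3, p. 63] -/
theorem exists_isUnit_mul_prod_pow_of_mul_eq_prod_pow [IsDomain R] {ι : Type v} (s : Finset ι)
    (p : ι → R) (hp : ∀ i ∈ s, Prime (p i)) (N : ℕ) {x y : R}
    (h : x * y = (∏ i ∈ s, p i) ^ N) :
    ∃ (m : ι → ℕ) (ε : R), IsUnit ε ∧ x = ε * ∏ i ∈ s, p i ^ m i := by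
  classical
  -- the product of primes indexed by `s × range N`
  have hprod : (∏ i ∈ s, p i) ^ N = ∏ q ∈ s ×ˢ Finset.range N, p q.1 := by
    rw [Finset.prod_product, ← Finset.prod_pow]
    refine Finset.prod_congr rfl fun i _ => ?_
    simp only [Finset.prod_const, Finset.card_range]
  have h' : x * y = 1 * ∏ q ∈ s ×ˢ Finset.range N, p q.1 := by rw [one_mul, ← hprod, h]
  obtain ⟨t, u, b, c, htu, -, hbc, hx, -⟩ :=
    mul_eq_mul_prime_prod (fun q hq => hp q.1 (Finset.mem_product.mp hq).1) h'
  have hb : IsUnit b := IsUnit.of_mul_eq_one c hbc.symm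
  have hts : ∀ q ∈ t, q.1 ∈ s := fun q hq => by
    have : q ∈ s ×ˢ Finset.range N := htu ▸ Finset.mem_union_left u hq
    exact (Finset.mem_product.mp this).1
  refine ⟨fun i => (t.filter fun q => q.1 = i).card, b, hb, ?_⟩
  rw [hx, ← Finset.prod_fiberwise_of_maps_to hts (fun q => p q.1)]
  congr 1
  refine Finset.prod_congr rfl fun i _ => ?_
  rw [← Finset.prod_const]
  exact Finset.prod_congr rfl fun q hq => by rw [(Finset.mem_filter.mp hq).2]

/-- **"By assumption we have `V(h) ⊂ V(t₁ ⋯ t_r)`"**, read as an ideal-theoretic statement: if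
every prime ideal containing `h` contains `g`, then `gᴺ ∈ (h)` for some `N` (`g` lies in the
radical of `(h)`). [folklore] -/
theorem exists_pow_mem_span_singleton_of_forall_isPrime {h g : R}
    (H : ∀ P : Ideal R, P.IsPrime → h ∈ P → g ∈ P) : ∃ N : ℕ, g ^ N ∈ Ideal.span {h} := by
  have hg : g ∈ (Ideal.span {h}).radical := by
    rw [Ideal.radical_eq_sInf, Ideal.mem_sInf]
    rintro J ⟨hJ, hJp⟩
    exact H J hJp (hJ (Ideal.mem_span_singleton_self h))
  exact hg

end Primes

/-! ## Rescaling `u` by a unit: `A⟦u, v⟧/(uv - εp) ≅ A⟦u, v⟧/(uv - p)` -/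

namespace DeJong1996

namespace NodeDeformationRing

section UnitScale

variable {A : Type u} [CommRing A]

/-- The weights `(ε, 1)` on the variables `u = X 0`, `v = X 1`. [folklore] -/
def scaleWeights (ε : A) : Fin 2 → A := fun j => if j = 0 then ε else 1

/-- The weight of `u` is `ε`. [folklore] -/
@[simp] theorem scaleWeights_zero (ε : A) : scaleWeights ε 0 = ε := rfl

/-- The weight of `v` is `1`. [folklore] -/
@[simp] theorem scaleWeights_one (ε : A) : scaleWeights ε 1 = 1 := by
  simp [scaleWeights]

/-- The weights are multiplicative in `ε`. [folklore] -/
theorem scaleWeights_mul (ε ε' : A) : scaleWeights ε * scaleWeights ε' = scaleWeights (ε * ε') := by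
  funext j
  fin_cases j <;> simp [scaleWeights]

/-- The weights of `ε = 1` are trivial. [folklore] -/
theorem scaleWeights_one_eq : scaleWeights (1 : A) = 1 := by
  funext j
  fin_cases j <;> simp [scaleWeights]

/-- `rescale (ε, 1)` multiplies `u` by `ε`. [folklore] -/
theorem rescale_scaleWeights_X_zero (ε : A) :
    MvPowerSeries.rescale (scaleWeights ε) (MvPowerSeries.X 0 : MvPowerSeries (Fin 2) A) =
      MvPowerSeries.C ε * MvPowerSeries.X 0 := by
  ext n
  rw [MvPowerSeries.coeff_rescale, MvPowerSeries.coeff_C_mul, MvPowerSeries.coeff_X]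
  split_ifs with hn
  · subst hn
    rw [Finsupp.prod_single_index (by simp), pow_one, scaleWeights_zero]
  · rw [mul_zero, mul_zero]

/-- `rescale (ε, 1)` fixes `v`. [folklore] -/
theorem rescale_scaleWeights_X_one (ε : A) :
    MvPowerSeries.rescale (scaleWeights ε) (MvPowerSeries.X 1 : MvPowerSeries (Fin 2) A) =
      MvPowerSeries.X 1 := by
  ext n
  rw [MvPowerSeries.coeff_rescale, MvPowerSeries.coeff_X]
  split_ifs with hn
  · subst hn
    rw [Finsupp.prod_single_index (by simp), pow_one, scaleWeights_one, one_mul]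
  · rw [mul_zero]

/-- `rescale` fixes the constants. [folklore] -/
theorem rescale_C {σ : Type v} (a : σ → A) (c : A) :
    MvPowerSeries.rescale a (MvPowerSeries.C c : MvPowerSeries σ A) = MvPowerSeries.C c := by
  classical
  ext n
  rw [MvPowerSeries.coeff_rescale, MvPowerSeries.coeff_C]
  split_ifs with hn
  · subst hn
    rw [Finsupp.prod_zero_index, one_mul]
  · rw [mul_zero]

/-- The automorphism `u ↦ εu`, `v ↦ v` of `A⟦u, v⟧` for a unit `ε`. [folklore] -/
def scaleEquiv (ε : Aˣ) : MvPowerSeries (Fin 2) A ≃+* MvPowerSeries (Fin 2) A :=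
  RingEquiv.ofRingHom (MvPowerSeries.rescale (scaleWeights (ε : A)))
    (MvPowerSeries.rescale (scaleWeights (↑ε⁻¹ : A)))
    (by rw [← MvPowerSeries.rescale_mul, scaleWeights_mul, Units.inv_mul, scaleWeights_one_eq,
          MvPowerSeries.rescale_one])
    (by rw [← MvPowerSeries.rescale_mul, scaleWeights_mul, Units.mul_inv, scaleWeights_one_eq,
          MvPowerSeries.rescale_one])

/-- Unfolding `scaleEquiv`. [folklore] -/
theorem scaleEquiv_apply (ε : Aˣ) (φ : MvPowerSeries (Fin 2) A) :
    scaleEquiv ε φ = MvPowerSeries.rescale (scaleWeights (ε : A)) φ := rfl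

/-- `u ↦ εu` carries the relation `uv - εp` to `ε (uv - p)`. [folklore] -/
theorem scaleEquiv_nodeDeformationRelation (ε : Aˣ) (p : A) :
    scaleEquiv ε (nodeDeformationRelation A (ε * p)) =
      MvPowerSeries.C (ε : A) * nodeDeformationRelation A p := by
  rw [scaleEquiv_apply, nodeDeformationRelation, nodeDeformationRelation, map_sub, map_mul,
    rescale_scaleWeights_X_zero, rescale_scaleWeights_X_one, rescale_C, map_mul]
  ring

/-- **"We change `Q` into `ε⁻¹ Q`"** (de Jong 1996, 3.3): for a unit `ε` of `A`, the
substitution `u ↦ εu` is an isomorphism `A⟦u, v⟧/(uv - εp) ≅ A⟦u, v⟧/(uv - p)`.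
[cite: DeJong1996, 3.3, p. 63] -/
def unitScale (ε : Aˣ) (p : A) :
    NodeDeformationRing A (ε * p) ≃+* NodeDeformationRing A p :=
  Ideal.quotientEquiv _ _ (scaleEquiv ε) (by
    rw [Ideal.map_span, Set.image_singleton, RingEquiv.coe_toRingHom,
      scaleEquiv_nodeDeformationRelation]
    exact (Ideal.span_singleton_mul_left_unit
      ((MvPowerSeries.isUnit_iff_constantCoeff (φ := MvPowerSeries.C (ε : A))).mpr
        (by rw [MvPowerSeries.constantCoeff_C]; exact Units.isUnit ε)) _).symm)

/-- `unitScale` on the class of a power series. [folklore] -/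
theorem unitScale_mk (ε : Aˣ) (p : A) (φ : MvPowerSeries (Fin 2) A) :
    unitScale ε p (Ideal.Quotient.mk _ φ) =
      Ideal.Quotient.mk _ (MvPowerSeries.rescale (scaleWeights (ε : A)) φ) :=
  rfl

/-- `unitScale` fixes the classes of the constants. [folklore] -/
theorem unitScale_mk_C (ε : Aˣ) (p : A) (a : A) :
    unitScale ε p (Ideal.Quotient.mk _ (MvPowerSeries.C a)) =
      Ideal.Quotient.mk _ (MvPowerSeries.C a) := by
  rw [unitScale_mk, rescale_C]

/-- `unitScale` is compatible with the structure maps. [folklore] -/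
theorem unitScale_comp_ofBase (ε : Aˣ) (p : A) :
    (unitScale ε p).toRingHom.comp (ofBase A (ε * p)) = ofBase A p :=
  RingHom.ext fun a => unitScale_mk_C ε p a

end UnitScale

/-! ## Evaluation at `u = v = 0` and the linear coefficients, modulo an ideal containing `h` -/

section LinCoeff

variable {P : Type u} [CommRing P] {h : P} (𝔓 : Ideal P) (hh : h ∈ 𝔓)

/-- The constant coefficient of the relation `uv - h` is `-h`. [folklore] -/
theorem constantCoeff_nodeDeformationRelation (h : P) :
    MvPowerSeries.constantCoeff (nodeDeformationRelation P h) = -h := by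
  rw [nodeDeformationRelation, map_sub, map_mul, MvPowerSeries.constantCoeff_X, zero_mul,
    zero_sub, MvPowerSeries.constantCoeff_C]

/-- The relation `uv - h` has no linear terms. [folklore] -/
theorem coeff_single_one_nodeDeformationRelation (h : P) (j : Fin 2) :
    MvPowerSeries.coeff (Finsupp.single j 1) (nodeDeformationRelation P h) = 0 := by
  classical
  rw [nodeDeformationRelation, map_sub, MvPowerSeries.coeff_single_one_mul,
    MvPowerSeries.constantCoeff_X, MvPowerSeries.constantCoeff_X, zero_mul, mul_zero, add_zero,
    MvPowerSeries.coeff_C, if_neg (Finsupp.single_ne_zero.mpr one_ne_zero), sub_zero]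

include hh in
/-- An element of the ideal `(uv - h)` has constant coefficient in `𝔓 ∋ h`. [folklore] -/
theorem constantCoeff_mem_of_mem_span {G : MvPowerSeries (Fin 2) P}
    (hG : G ∈ Ideal.span {nodeDeformationRelation P h}) :
    MvPowerSeries.constantCoeff G ∈ 𝔓 := by
  obtain ⟨c, rfl⟩ := Ideal.mem_span_singleton'.mp hG
  rw [map_mul, constantCoeff_nodeDeformationRelation, mul_neg]
  exact 𝔓.neg_mem (𝔓.mul_mem_left _ hh)

include hh in
/-- An element of the ideal `(uv - h)` has linear coefficients in `𝔓 ∋ h`. [folklore] -/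
theorem coeff_single_one_mem_of_mem_span {G : MvPowerSeries (Fin 2) P}
    (hG : G ∈ Ideal.span {nodeDeformationRelation P h}) (j : Fin 2) :
    MvPowerSeries.coeff (Finsupp.single j 1) G ∈ 𝔓 := by
  obtain ⟨c, rfl⟩ := Ideal.mem_span_singleton'.mp hG
  rw [MvPowerSeries.coeff_single_one_mul, coeff_single_one_nodeDeformationRelation, mul_zero,
    zero_add, constantCoeff_nodeDeformationRelation, mul_neg]
  exact 𝔓.neg_mem (𝔓.mul_mem_left _ hh)

/-- **Evaluation at `u = v = 0` modulo `𝔓`**: the ring homomorphism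
`P⟦u, v⟧/(uv - h) → P/𝔓`, `u, v ↦ 0`, well defined since `h ∈ 𝔓` (its kernel is the ideal
`(u, v, 𝔓)` of the model). [folklore] -/
def ccBar : NodeDeformationRing P h →+* P ⧸ 𝔓 :=
  Ideal.Quotient.lift _ ((Ideal.Quotient.mk 𝔓).comp MvPowerSeries.constantCoeff)
    (fun _ hG => (Ideal.Quotient.eq_zero_iff_mem).mpr (constantCoeff_mem_of_mem_span 𝔓 hh hG))

/-- `ccBar` on the class of a power series is its constant coefficient modulo `𝔓`. [folklore] -/
@[simp] theorem ccBar_mk (G : MvPowerSeries (Fin 2) P) :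
    ccBar 𝔓 hh (Ideal.Quotient.mk (Ideal.span {nodeDeformationRelation P h}) G) =
      Ideal.Quotient.mk 𝔓 (MvPowerSeries.constantCoeff G) :=
  rfl

/-- **The coefficient of `u` (`j = 0`) resp. `v` (`j = 1`) modulo `𝔓`** of an element of
`P⟦u, v⟧/(uv - h)`, well defined since `h ∈ 𝔓`. [folklore] -/
def linCoeff (j : Fin 2) (F : NodeDeformationRing P h) : P ⧸ 𝔓 :=
  Ideal.Quotient.mk 𝔓
    (MvPowerSeries.coeff (Finsupp.single j 1) (Ideal.Quotient.mk_surjective F).choose)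

include hh in
/-- `linCoeff j` on the class of a power series is its `Xⱼ`-coefficient modulo `𝔓` (well defined
as `h ∈ 𝔓`). [folklore] -/
theorem linCoeff_mk (j : Fin 2) (G : MvPowerSeries (Fin 2) P) :
    linCoeff 𝔓 j (Ideal.Quotient.mk (Ideal.span {nodeDeformationRelation P h}) G) =
      Ideal.Quotient.mk 𝔓 (MvPowerSeries.coeff (Finsupp.single j 1) G) := by
  have hG := (Ideal.Quotient.mk_surjective
    (Ideal.Quotient.mk (Ideal.span {nodeDeformationRelation P h}) G)).choose_spec
  rw [linCoeff, Ideal.Quotient.eq, ← map_sub]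
  refine coeff_single_one_mem_of_mem_span 𝔓 hh ?_ j
  rw [← Ideal.Quotient.eq]
  exact hG

include hh in
/-- `linCoeff` is additive. [folklore] -/
theorem linCoeff_add (j : Fin 2) (F G : NodeDeformationRing P h) :
    linCoeff 𝔓 j (F + G) = linCoeff 𝔓 j F + linCoeff 𝔓 j G := by
  obtain ⟨F, rfl⟩ := Ideal.Quotient.mk_surjective F
  obtain ⟨G, rfl⟩ := Ideal.Quotient.mk_surjective G
  rw [← map_add, linCoeff_mk 𝔓 hh, linCoeff_mk 𝔓 hh, linCoeff_mk 𝔓 hh, map_add, map_add]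

include hh in
/-- `linCoeff` commutes with negation. [folklore] -/
theorem linCoeff_neg (j : Fin 2) (F : NodeDeformationRing P h) :
    linCoeff 𝔓 j (-F) = -linCoeff 𝔓 j F := by
  obtain ⟨F, rfl⟩ := Ideal.Quotient.mk_surjective F
  rw [← map_neg, linCoeff_mk 𝔓 hh, linCoeff_mk 𝔓 hh, map_neg, map_neg]

include hh in
/-- `linCoeff` commutes with subtraction. [folklore] -/
theorem linCoeff_sub (j : Fin 2) (F G : NodeDeformationRing P h) :
    linCoeff 𝔓 j (F - G) = linCoeff 𝔓 j F - linCoeff 𝔓 j G := by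
  rw [sub_eq_add_neg, linCoeff_add 𝔓 hh, linCoeff_neg 𝔓 hh, ← sub_eq_add_neg]

include hh in
/-- **Leibniz rule** for the linear coefficients: `(FG)ⱼ = F(0) Gⱼ + Fⱼ G(0)`. [folklore] -/
theorem linCoeff_mul (j : Fin 2) (F G : NodeDeformationRing P h) :
    linCoeff 𝔓 j (F * G) = ccBar 𝔓 hh F * linCoeff 𝔓 j G + linCoeff 𝔓 j F * ccBar 𝔓 hh G := by
  obtain ⟨F, rfl⟩ := Ideal.Quotient.mk_surjective F
  obtain ⟨G, rfl⟩ := Ideal.Quotient.mk_surjective G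
  rw [← map_mul, linCoeff_mk 𝔓 hh, linCoeff_mk 𝔓 hh, linCoeff_mk 𝔓 hh, ccBar_mk, ccBar_mk,
    MvPowerSeries.coeff_single_one_mul, map_add, map_mul, map_mul]

include hh in
/-- `linCoeff` vanishes on the constants. [folklore] -/
theorem linCoeff_mk_C (j : Fin 2) (p : P) :
    linCoeff 𝔓 j (Ideal.Quotient.mk (Ideal.span {nodeDeformationRelation P h}) (MvPowerSeries.C p)) =
      0 := by
  classical
  rw [linCoeff_mk 𝔓 hh, MvPowerSeries.coeff_C, if_neg (Finsupp.single_ne_zero.mpr one_ne_zero),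
    map_zero]

include hh in
/-- `linCoeff j` is `1` on the `j`-th variable and `0` on the other. [folklore] -/
theorem linCoeff_mk_X (j i : Fin 2) :
    linCoeff 𝔓 j (Ideal.Quotient.mk (Ideal.span {nodeDeformationRelation P h}) (MvPowerSeries.X i)) =
      if i = j then 1 else 0 := by
  classical
  rw [linCoeff_mk 𝔓 hh, MvPowerSeries.coeff_X]
  by_cases hij : i = j
  · subst hij
    rw [if_pos rfl, if_pos rfl, map_one]
  · rw [if_neg (fun h => hij (Finsupp.single_left_injective one_ne_zero h).symm), if_neg hij,
      map_zero]

/-- Over a local ring `P`, a power series lies in the maximal ideal of `P⟦X⟧` iff its constant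
coefficient lies in the maximal ideal of `P` (kept under `Literature.AlgebraicGeometry.Resolution`,
next to `MvPowerSeries.mem_maximalIdeal_iff_constantCoeff` of `AlterationsFormalNodesRegular.lean`,
which is the case of a field). [folklore] -/
theorem _root_.Literature.AlgebraicGeometry.Resolution.MvPowerSeries.mem_maximalIdeal_iff_constantCoeff_mem {σ : Type v} [IsLocalRing P]
    {φ : MvPowerSeries σ P} :
    φ ∈ maximalIdeal (MvPowerSeries σ P) ↔ MvPowerSeries.constantCoeff φ ∈ maximalIdeal P := by
  rw [mem_maximalIdeal, mem_nonunits_iff, MvPowerSeries.isUnit_iff_constantCoeff,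
    mem_maximalIdeal, mem_nonunits_iff]

/-- Over a local ring `P`, elements of `𝔫²`, `𝔫` the maximal ideal of `P⟦X⟧`, have linear
coefficients in `𝔪_P` (kept under `Literature.AlgebraicGeometry.Resolution`, next to
`MvPowerSeries.coeff_single_one_eq_zero_of_mem_sq` of `AlterationsFormalNodesRegular.lean`, the
case of a field). [folklore] -/
theorem _root_.Literature.AlgebraicGeometry.Resolution.MvPowerSeries.coeff_single_one_mem_maximalIdeal_of_mem_sq {σ : Type v}
    [IsLocalRing P] (j : σ) {φ : MvPowerSeries σ P}
    (hφ : φ ∈ maximalIdeal (MvPowerSeries σ P) ^ 2) :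
    MvPowerSeries.coeff (Finsupp.single j 1) φ ∈ maximalIdeal P := by
  rw [pow_two] at hφ
  refine Submodule.mul_induction_on hφ (fun p hp q hq => ?_) (fun p q hp hq => ?_)
  · rw [MvPowerSeries.coeff_single_one_mul]
    rw [MvPowerSeries.mem_maximalIdeal_iff_constantCoeff_mem] at hp hq
    exact Ideal.add_mem _ (Ideal.mul_mem_right _ _ hp) (Ideal.mul_mem_left _ _ hq)
  · rw [map_add]
    exact Ideal.add_mem _ hp hq

include hh in
/-- **An element of `𝔪²`, `𝔪` the maximal ideal of the local ring `P⟦u, v⟧/(uv - h)` (`P` local,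
`h ∈ 𝔪_P`), has linear coefficients in `𝔪_P` modulo `𝔓`.** [folklore] -/
theorem linCoeff_mem_of_mem_sq [IsLocalRing P] (hm : h ∈ maximalIdeal P) (j : Fin 2)
    {F : NodeDeformationRing P h}
    (hF : letI := NodeDeformationRing.isLocalRing hm; F ∈ maximalIdeal (NodeDeformationRing P h) ^ 2) :
    linCoeff 𝔓 j F ∈ (maximalIdeal P).map (Ideal.Quotient.mk 𝔓) := by
  letI := NodeDeformationRing.isLocalRing hm
  have hmax : maximalIdeal (NodeDeformationRing P h) =
      (maximalIdeal (MvPowerSeries (Fin 2) P)).map (Ideal.Quotient.mk _) :=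
    (DeJong1996.SemiStablePair.map_mk_maximalIdeal_eq _).symm
  rw [hmax, ← Ideal.map_pow, Ideal.mem_map_iff_of_surjective _ Ideal.Quotient.mk_surjective] at hF
  obtain ⟨G, hG, rfl⟩ := hF
  rw [linCoeff_mk 𝔓 hh]
  exact Ideal.mem_map_of_mem _ (MvPowerSeries.coeff_single_one_mem_maximalIdeal_of_mem_sq j hG)

end LinCoeff

end NodeDeformationRing

/-! ## `k⟦u, v, T⟧/(uv - T_{i₀})` is regular -/

namespace FormalNodeRing

/-- **"(if `Σ nᵢ = 1`, then the point `x` is regular on `X`)"** (de Jong 1996, 3.3): the formal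
node ring `k⟦u, v, T₁, …, T_m⟧/(uv - T_{i₀})` is a regular local ring — the relation has the
linear term `-T_{i₀}`, so it lies in `𝔪 ∖ 𝔪²` of the regular local ring `k⟦u, v, T⟧`
(Matsumura, Thm. 14.2). [cite: DeJong1996, 3.3, p. 63] -/
theorem isRegularLocalRing_single (k : Type u) [Field k] {m : ℕ} (i₀ : Fin m) :
    IsRegularLocalRing (FormalNodeRing k m (Pi.single i₀ 1)) := by
  classical
  haveI : IsRegularLocalRing (MvPowerSeries (Fin 2 ⊕ Fin m) k) :=
    isRegularLocalRing_mvPowerSeries k (Fin 2 ⊕ Fin m)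
  have hrel : formalNodeRelation k m (Pi.single i₀ 1) =
      MvPowerSeries.X (Sum.inl 0) * MvPowerSeries.X (Sum.inl 1) - MvPowerSeries.X (Sum.inr i₀) := by
    rw [formalNodeRelation]
    congr 1
    rw [Finset.prod_eq_single i₀ (fun j _ hj => by rw [Pi.single_apply, if_neg hj, pow_zero])
      (fun h => absurd (Finset.mem_univ i₀) h), Pi.single_eq_same, pow_one]
  have hmem : formalNodeRelation k m (Pi.single i₀ 1) ∈ maximalIdeal (MvPowerSeries (Fin 2 ⊕ Fin m) k) :=
    (formalNodeRelation_mem_maximalIdeal_iff k m _).mpr ⟨i₀, by rw [Pi.single_eq_same]; exact one_ne_zero⟩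
  have hsq : formalNodeRelation k m (Pi.single i₀ 1) ∉ maximalIdeal (MvPowerSeries (Fin 2 ⊕ Fin m) k) ^ 2 := by
    intro hsq
    have h0 := MvPowerSeries.coeff_single_one_eq_zero_of_mem_sq (Sum.inr i₀) hsq
    rw [hrel, map_sub, MvPowerSeries.coeff_single_one_mul, MvPowerSeries.constantCoeff_X,
      MvPowerSeries.constantCoeff_X, zero_mul, mul_zero, add_zero, zero_sub,
      MvPowerSeries.coeff_X, if_pos rfl, neg_eq_zero] at h0
    exact one_ne_zero h0
  exact (IsRegularLocalRing.quotient_span_singleton hmem hsq).1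

end FormalNodeRing

end DeJong1996

/-! ## Two independent derivations force `Fitt₁(Ω) ⊆` the kernel -/

section Fitting

open TensorProduct Literature.RingTheory.FittingIdeal

variable {A : Type u} {B : Type v} {L : Type w} [CommRing A] [CommRing B] [Algebra A B]
  [Field L] [Algebra B L] [Algebra A L] [IsScalarTower A B L]

/-- The `L`-linear functional on `L ⊗_B Ω_{B/A}` induced by an `A`-derivation `B → L`.
[folklore] -/
def derivationFunctional (D : Derivation A B L) : L ⊗[B] Ω[B⁄A] →ₗ[L] L :=
  (Algebra.TensorProduct.lmul'' (S := L) B).toLinearMap ∘ₗ (D.liftKaehlerDifferential.baseChange L)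

omit [IsScalarTower A B L] in
/-- `derivationFunctional D (l ⊗ ω) = l · D̃(ω)`. [folklore] -/
theorem derivationFunctional_tmul [IsScalarTower A B L] (D : Derivation A B L) (l : L) (ω : Ω[B⁄A]) :
    derivationFunctional D (l ⊗ₜ ω) = l * D.liftKaehlerDifferential ω := by
  simp only [derivationFunctional, LinearMap.coe_comp, Function.comp_apply, LinearMap.baseChange_tmul]
  rfl

/-- `derivationFunctional D (1 ⊗ db) = D b`. [folklore] -/
theorem derivationFunctional_one_tmul_D (D : Derivation A B L) (b : B) :
    derivationFunctional D ((1 : L) ⊗ₜ KaehlerDifferential.D A B b) = D b := by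
  rw [derivationFunctional_tmul, Derivation.liftKaehlerDifferential_comp_D, one_mul]

/-- **Two `A`-derivations `B → L` with an invertible matrix of values on `b₀, b₁ ∈ B` make
`1 ⊗ db₀`, `1 ⊗ db₁` linearly independent in `L ⊗_B Ω_{B/A}`**, so this `L`-vector space has
dimension `≥ 2`. [folklore] -/
theorem two_le_finrank_baseChange_kaehlerDifferential [Module.Finite B Ω[B⁄A]]
    (D₀ D₁ : Derivation A B L) (b₀ b₁ : B) (hdet : D₀ b₀ * D₁ b₁ - D₀ b₁ * D₁ b₀ ≠ 0) :
    2 ≤ Module.finrank L (L ⊗[B] Ω[B⁄A]) := by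
  set w₀ : L ⊗[B] Ω[B⁄A] := (1 : L) ⊗ₜ KaehlerDifferential.D A B b₀
  set w₁ : L ⊗[B] Ω[B⁄A] := (1 : L) ⊗ₜ KaehlerDifferential.D A B b₁
  have hli : LinearIndependent L ![w₀, w₁] := by
    rw [LinearIndependent.pair_iff]
    intro s t hst
    have h0 := congrArg (derivationFunctional D₀) hst
    have h1 := congrArg (derivationFunctional D₁) hst
    simp only [map_add, map_smul, map_zero, smul_eq_mul, w₀, w₁,
      derivationFunctional_one_tmul_D] at h0 h1
    have hs : s * (D₀ b₀ * D₁ b₁ - D₀ b₁ * D₁ b₀) = 0 := by linear_combination (D₁ b₁) * h0 - (D₀ b₁) * h1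
    have ht : t * (D₀ b₀ * D₁ b₁ - D₀ b₁ * D₁ b₀) = 0 := by linear_combination (D₀ b₀) * h1 - (D₁ b₀) * h0
    exact ⟨(mul_eq_zero.mp hs).resolve_right hdet, (mul_eq_zero.mp ht).resolve_right hdet⟩
  have h := hli.fintype_card_le_finrank
  rwa [Fintype.card_fin] at h

/-- **`Fitt₁(Ω_{B/A}) ⊆ ker (B → L)` from two independent derivations.** For an `A`-algebra `B`
with `Ω_{B/A}` finite and a field `L` under `B`: if `A`-derivations `D₀, D₁ : B → L` have
`D₀ b₀ · D₁ b₁ - D₀ b₁ · D₁ b₀ ≠ 0` for some `b₀, b₁ ∈ B`, then `Fitt₁(Ω_{B/A})` maps to `0` in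
`L` — Fitting ideals commute with base change (Eisenbud Cor. 20.5), and `Fitt₁` of an
`L`-vector space of dimension `≥ 2` vanishes. (At a prime `𝔮 = ker (B → L)` of `B` this says:
`𝔮 ∈ V(Fitt₁ Ω_{B/A}) = Sing`, the fibre through `𝔮` needing two differentials.)
[cite: Eisenbud1995, Cor. 20.5] -/
theorem fittingIdeal_kaehlerDifferential_le_ker_of_derivation [Module.Finite B Ω[B⁄A]]
    (D₀ D₁ : Derivation A B L) (b₀ b₁ : B) (hdet : D₀ b₀ * D₁ b₁ - D₀ b₁ * D₁ b₀ ≠ 0) :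
    Module.fittingIdeal B Ω[B⁄A] 1 ≤ RingHom.ker (algebraMap B L) := by
  have h2 := two_le_finrank_baseChange_kaehlerDifferential D₀ D₁ b₀ b₁ hdet
  have hV : Module.fittingIdeal L (L ⊗[B] Ω[B⁄A]) 1 = ⊥ := by
    rw [Module.fittingIdeal_eq_bot_iff_lt_finrank]
    omega
  rw [Module.fittingIdeal_baseChange] at hV
  exact (Ideal.map_eq_bot_iff_le_ker _).mp hV

end Fitting

/-! ## The two derivations along `V(u, v, 𝔓)`: `Fitt₁(Ω_{B/A}) ⊆ 𝔮` -/

namespace DeJong1996.NodeDeformationRing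

open NodalDeformation Literature.RingTheory.FittingIdeal

variable {A B : Type u} [CommRing A] [CommRing B] [IsLocalRing B] [IsNoetherianRing B]
  [Algebra A B] {P : Type u} [CommRing P] [IsLocalRing P] {h : P}

/-- The map `B → B̂ ≅ P⟦u, v⟧/(uv - h) → P/𝔓 → Frac(P/𝔓)`: completion, the formal structure,
evaluation at `u = v = 0` (defined as `h ∈ 𝔓`), and the fraction field. [folklore] -/
def evalZeroFrac (Ψ : Cpl B ≃+* NodeDeformationRing P h) (𝔓 : Ideal P) (hh : h ∈ 𝔓) :
    B →+* FractionRing (P ⧸ 𝔓) :=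
  (algebraMap (P ⧸ 𝔓) (FractionRing (P ⧸ 𝔓))).comp
    ((ccBar 𝔓 hh).comp (Ψ.toRingHom.comp (algebraMap B (Cpl B))))

omit [IsNoetherianRing B] [IsLocalRing P] in
/-- Unfolding `evalZeroFrac`. [folklore] -/
theorem evalZeroFrac_apply (Ψ : Cpl B ≃+* NodeDeformationRing P h) (𝔓 : Ideal P) (hh : h ∈ 𝔓)
    (b : B) :
    evalZeroFrac Ψ 𝔓 hh b =
      algebraMap (P ⧸ 𝔓) (FractionRing (P ⧸ 𝔓)) (ccBar 𝔓 hh (Ψ (algebraMap B (Cpl B) b))) :=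
  rfl

/-- **`Fitt₁(Ω_{B/A}) ⊆ 𝔮` for the prime `𝔮 = ker (B → Frac(P/𝔓))` of a formal node structure.**
Let `A → B` be local Noetherian with `Ω_{B/A}` finite, `Ψ : B̂ ≅ P⟦u, v⟧/(uv - h)` an isomorphism
under which `A` acts through constants (`Ψ(a) = ι'(a)`), `P` local, `h ∈ 𝔪_P`, and `𝔓 ∋ h` a
prime of `P`. Then the first Fitting ideal of `Ω_{B/A}` dies in `Frac(P/𝔓)` along
`B → B̂ → P⟦u, v⟧/(uv - h) → P/𝔓` (`u, v ↦ 0`): the coefficients of `u` and of `v` modulo `𝔓`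
are two `A`-derivations `B → Frac(P/𝔓)` whose values on approximations of `u, v` in `B` form
a matrix `≡ 1 (mod 𝔪)`. [cite: DeJong1996, 2.23 Remark and 3.3, pp. 62–63] -/
theorem fittingIdeal_le_ker_evalZeroFrac [Algebra.EssFiniteType A B]
    (Ψ : Cpl B ≃+* NodeDeformationRing P h) (ι' : A →+* P)
    (hΨ : ∀ a : A, Ψ (algebraMap B (Cpl B) (algebraMap A B a)) =
      Ideal.Quotient.mk _ (MvPowerSeries.C (ι' a)))
    (hm : h ∈ maximalIdeal P) (𝔓 : Ideal P) [𝔓.IsPrime] (hh : h ∈ 𝔓) :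
    Module.fittingIdeal B Ω[B⁄A] 1 ≤ RingHom.ker (evalZeroFrac Ψ 𝔓 hh) := by
  classical
  -- notation
  set R₀ : Type u := P ⧸ 𝔓 with hR₀
  set L : Type u := FractionRing R₀ with hL
  set M := NodeDeformationRing P h with hM
  haveI hMloc : IsLocalRing M := NodeDeformationRing.isLocalRing hm
  have h𝔓 : 𝔓 ≠ ⊤ := Ideal.IsPrime.ne_top inferInstance
  haveI : Nontrivial R₀ := Ideal.Quotient.nontrivial_iff.mpr h𝔓
  haveI : IsLocalRing R₀ := IsLocalRing.of_surjective' (Ideal.Quotient.mk 𝔓) Ideal.Quotient.mk_surjective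
  set θ : B →+* M := Ψ.toRingHom.comp (algebraMap B (Cpl B)) with hθ
  set χ : B →+* L := evalZeroFrac Ψ 𝔓 hh with hχ
  have hχθ : ∀ b, χ b = algebraMap R₀ L (ccBar 𝔓 hh (θ b)) := fun b => rfl
  have hθA : ∀ a : A, θ (algebraMap A B a) = Ideal.Quotient.mk _ (MvPowerSeries.C (ι' a)) := hΨ
  -- `L` as a `B`- and an `A`-algebra through `χ`
  letI algBL : Algebra B L := χ.toAlgebra
  letI algAL : Algebra A L := (χ.comp (algebraMap A B)).toAlgebra
  haveI : IsScalarTower A B L := IsScalarTower.of_algebraMap_eq (fun _ => rfl)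
  haveI : Module.Finite B Ω[B⁄A] := inferInstance
  -- the two derivations
  have hlin : ∀ (j : Fin 2) (a : A) (b : B),
      algebraMap R₀ L (linCoeff 𝔓 j (θ (a • b))) = a • algebraMap R₀ L (linCoeff 𝔓 j (θ b)) := by
    intro j a b
    rw [Algebra.smul_def, map_mul, linCoeff_mul 𝔓 hh, hθA a, linCoeff_mk_C 𝔓 hh, zero_mul,
      add_zero, map_mul, Algebra.smul_def]
    congr 1
    change _ = χ (algebraMap A B a)
    rw [hχθ, hθA]
  let Dlin : Fin 2 → (B →ₗ[A] L) := fun j =>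
    { toFun := fun b => algebraMap R₀ L (linCoeff 𝔓 j (θ b))
      map_add' := fun b c => by
        simp only [map_add, linCoeff_add 𝔓 hh]
      map_smul' := fun a b => hlin j a b }
  have hDlin : ∀ j b, Dlin j b = algebraMap R₀ L (linCoeff 𝔓 j (θ b)) := fun _ _ => rfl
  let D : Fin 2 → Derivation A B L := fun j =>
    Derivation.mk' (Dlin j) (fun b c => by
      rw [hDlin, hDlin, hDlin, map_mul, linCoeff_mul 𝔓 hh, map_add, map_mul, map_mul,
        Algebra.smul_def, Algebra.smul_def]
      change _ = χ b * _ + χ c * _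
      rw [hχθ, hχθ]
      ring)
  have hD : ∀ j b, D j b = algebraMap R₀ L (linCoeff 𝔓 j (θ b)) := fun _ _ => rfl
  -- approximations `b₀, b₁ ∈ B` of `u, v` modulo `𝔪̂²`
  have happrox : ∀ j : Fin 2, ∃ b : B, ∃ d ∈ maximalIdeal M ^ 2,
      θ b = Ideal.Quotient.mk _ (MvPowerSeries.X j) - d := by
    intro j
    obtain ⟨b, hb⟩ := exists_sub_algebraMap_mem_pow (A := B) (Ψ.symm (Ideal.Quotient.mk _ (MvPowerSeries.X j))) 2
    refine ⟨b, Ψ (Ψ.symm (Ideal.Quotient.mk _ (MvPowerSeries.X j)) - algebraMap B (Cpl B) b), ?_, ?_⟩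
    · have hmap : (maximalIdeal (Cpl B) ^ 2).map Ψ = maximalIdeal M ^ 2 := by
        rw [Ideal.map_pow, map_ringEquiv_maximalIdeal Ψ]
      rw [← hmap]
      exact Ideal.mem_map_of_mem Ψ hb
    · rw [map_sub, RingEquiv.apply_symm_apply, sub_sub_cancel]
      rfl
  obtain ⟨b₀, d₀, hd₀, hb₀⟩ := happrox 0
  obtain ⟨b₁, d₁, hd₁, hb₁⟩ := happrox 1
  -- the matrix of values modulo `𝔪`
  set 𝔪' : Ideal R₀ := (maximalIdeal P).map (Ideal.Quotient.mk 𝔓) with h𝔪'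
  have h𝔪'le : 𝔪' ≤ maximalIdeal R₀ := by
    haveI : IsLocalHom (Ideal.Quotient.mk 𝔓) :=
      IsLocalHom.of_surjective _ Ideal.Quotient.mk_surjective
    exact ((local_hom_TFAE (Ideal.Quotient.mk 𝔓)).out 0 2).mp ‹_›
  have hval : ∀ i j : Fin 2, ∀ {b : B} {d : M}, d ∈ maximalIdeal M ^ 2 →
      θ b = Ideal.Quotient.mk _ (MvPowerSeries.X j) - d →
      ∃ m ∈ 𝔪', linCoeff 𝔓 i (θ b) = (if j = i then 1 else 0) - m := by
    intro i j b d hd hb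
    refine ⟨linCoeff 𝔓 i d, linCoeff_mem_of_mem_sq 𝔓 hh hm i hd, ?_⟩
    rw [hb, linCoeff_sub 𝔓 hh, linCoeff_mk_X 𝔓 hh]
  obtain ⟨m₀₀, hm₀₀, h₀₀⟩ := hval 0 0 hd₀ hb₀
  obtain ⟨m₁₀, hm₁₀, h₁₀⟩ := hval 1 0 hd₀ hb₀
  obtain ⟨m₀₁, hm₀₁, h₀₁⟩ := hval 0 1 hd₁ hb₁
  obtain ⟨m₁₁, hm₁₁, h₁₁⟩ := hval 1 1 hd₁ hb₁
  simp only [if_true, show ((0 : Fin 2) = 1) = False from by decide,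
    show ((1 : Fin 2) = 0) = False from by decide, if_false] at h₀₀ h₁₀ h₀₁ h₁₁
  -- the determinant is a unit of `R₀`
  set det₀ : R₀ := linCoeff 𝔓 0 (θ b₀) * linCoeff 𝔓 1 (θ b₁) -
    linCoeff 𝔓 0 (θ b₁) * linCoeff 𝔓 1 (θ b₀) with hdet₀
  have hdet_unit : IsUnit det₀ := by
    have hmem : 1 - det₀ ∈ maximalIdeal R₀ := by
      have e : 1 - det₀ = m₀₀ + m₁₁ - m₀₀ * m₁₁ + m₀₁ * m₁₀ := by
        rw [hdet₀, h₀₀, h₁₀, h₀₁, h₁₁]; ring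
      rw [e]
      refine Ideal.add_mem _ (Ideal.sub_mem _ (Ideal.add_mem _ (h𝔪'le hm₀₀) (h𝔪'le hm₁₁))
        (Ideal.mul_mem_left _ _ (h𝔪'le hm₁₁))) (Ideal.mul_mem_left _ _ (h𝔪'le hm₁₀))
    by_contra hu
    have h1 : (1 : R₀) ∈ maximalIdeal R₀ := by
      have := Ideal.add_mem _ hmem ((mem_maximalIdeal _).mpr (mem_nonunits_iff.mpr hu))
      rwa [sub_add_cancel] at this
    exact (maximalIdeal.isMaximal R₀).ne_top (Ideal.eq_top_of_isUnit_mem _ h1 isUnit_one)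
  have hdet : D 0 b₀ * D 1 b₁ - D 0 b₁ * D 1 b₀ ≠ 0 := by
    rw [hD, hD, hD, hD, ← map_mul, ← map_mul, ← map_sub]
    intro h0
    exact hdet_unit.ne_zero (IsFractionRing.injective R₀ L (by rw [h0, map_zero]))
  -- conclude
  exact fittingIdeal_kaehlerDifferential_le_ker_of_derivation (D 0) (D 1) b₀ b₁ hdet

end DeJong1996.NodeDeformationRing

/-! ## Completions of a field are domains -/

/-- The adic completion of an integral domain at the zero ideal is an integral domain (it is the
ring itself). [folklore] -/
theorem isDomain_adicCompletion_of_eq_bot {R : Type u} [CommRing R] [IsDomain R] {I : Ideal R}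
    (hI : I = ⊥) : IsDomain (AdicCompletion I R) := by
  subst hI
  exact MulEquiv.isDomain R (AdicCompletion.ofAlgEquiv (⊥ : Ideal R)).symm.toMulEquiv

/-! ## Compatibility of a retargeted structure isomorphism with the structure maps -/

/-- Bookkeeping: if `eF : S ≅ A⟦u, v⟧/(uv - p)` sends `φ(a)` to the class of the constant `a`,
then so does its composite with the identity-coefficient change `p = p'`, i.e. the composite
with `φ` is the structure map `ofBase`. [folklore] -/
theorem DeJong1996.NodeDeformationRing.trans_congr_refl_comp_eq_ofBase {A S : Type u} [CommRing A]
    [CommRing S] (φ : A →+* S) {p p' : A} (eF : S ≃+* NodeDeformationRing A p)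
    (heF : ∀ a, eF (φ a) = Ideal.Quotient.mk _ (MvPowerSeries.C a)) (hpp : RingEquiv.refl A p = p') :
    (eF.trans (congr (RingEquiv.refl A) p p' hpp)).toRingHom.comp φ = ofBase A p' := by
  subst hpp
  refine RingHom.ext fun a => ?_
  change congr (RingEquiv.refl A) p _ rfl (eF (φ a)) = _
  rw [heF, congr_mk_C, ofBase_apply]
  rfl

/-! ## Bookkeeping on `Fin (r + e)` -/

/-- `∏ⱼ Xⱼ ^ (append m 0)ⱼ = ∏ᵢ X_{castAdd i} ^ mᵢ`. [folklore] -/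
theorem prod_pow_fin_append_zero {M : Type*} [CommMonoid M] {r e : ℕ} (x : Fin (r + e) → M)
    (m : Fin r → ℕ) :
    ∏ j, x j ^ (Fin.append m (0 : Fin e → ℕ) j) = ∏ i, x (Fin.castAdd e i) ^ m i := by
  rw [Fin.prod_univ_add]
  have h2 : ∏ j : Fin e, x (Fin.natAdd r j) ^ (Fin.append m (0 : Fin e → ℕ) (Fin.natAdd r j)) = 1 :=
    Finset.prod_eq_one fun j _ => by rw [Fin.append_right, Pi.zero_apply, pow_zero]
  rw [h2, mul_one]
  exact Finset.prod_congr rfl fun i _ => by rw [Fin.append_left]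

/-- `Σⱼ (append m 0)ⱼ = Σᵢ mᵢ`. [folklore] -/
theorem sum_fin_append_zero {r e : ℕ} (m : Fin r → ℕ) :
    ∑ j, Fin.append m (0 : Fin e → ℕ) j = ∑ i, m i := by
  rw [Fin.sum_univ_add]
  have h2 : ∑ j : Fin e, Fin.append m (0 : Fin e → ℕ) (Fin.natAdd r j) = 0 :=
    Finset.sum_eq_zero fun j _ => by rw [Fin.append_right, Pi.zero_apply]
  rw [h2, add_zero]
  exact Finset.sum_congr rfl fun i _ => by rw [Fin.append_left]

end Literature.AlgebraicGeometry.Resolution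

end
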